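import Mathlib
import Summits.Ventures.PercRepro.TriangleCapRowPlusOne
import Summits.Ventures.PercRepro.TriangleCapRowPlusTwo
import Summits.Ventures.PercRepro.TriangleCapStarMatch

/-!
# PercRepro — THE `K₄⁻`-FREE CHERRY TABLE ABOVE THE THRESHOLD, ALL ROWS `t ≥ 1` AS ONE STATEMENT
(p3, gen 31; part 12 — the rows `t = 1, 2, 3` of TriangleCapDiagonal / RowPlusOne / RowPlusTwo and the rows
`t ≥ 4` of TriangleCapRowGeneral under one threshold)

For `t ≥ 1` and `k ≥ (t² − t + 6)/2` (`3, 4, 6, 9, 13, …` at `t = 1, 2, 3, 4, 5, …`) every `K₄⁻`-free graph with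
`k − 1 + t` edges on `k` vertices has `Σ_v C(d(v), 2) ≤ C(k − 1, 2) + 2t` (**`cherries_le_star_value`**), and for
`k ≥ 2t + 1` the star plus `t` disjoint leaf edges attains it (**`rows_exact`**).  The rows `t = 1` (every graph
with `m ≤ k` edges, no threshold) and `t = 2` (every `k`, the row `m = k + 1`) come from the earlier modules,
`t = 3` is TriangleCapRowPlusTwo (threshold `6`), `t ≥ 4` is TriangleCapRowGeneral; the threshold is sharp for
`t ≥ 4` (TriangleCapBipPendant).  Axioms: standard.
-/

namespace PercRepro

namespace TriangleCap

namespace C047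

open Finset

variable {V : Type*} [Fintype V] [DecidableEq V]

/-- **THE STAR VALUE BOUNDS EVERY ROW ABOVE THE THRESHOLD:** for `t ≥ 1` and `t² + 6 ≤ 2k + t` every
`K₄⁻`-free graph with `k − 1 + t` edges on `k` vertices has `Σ_v C(d(v), 2) ≤ C(k − 1, 2) + 2t`. -/
theorem cherries_le_star_value (t : ℕ) (ht : 1 ≤ t) (D : SimpleGraph V) [DecidableRel D.Adj]
    (hK : K4mFree D) (hk : t * t + 6 ≤ 2 * Fintype.card V + t)
    (hm : D.edgeFinset.card + 1 = Fintype.card V + t) :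
    cherries D ≤ (Fintype.card V - 1).choose 2 + 2 * t := by
  rcases (by omega : t = 1 ∨ t = 2 ∨ t = 3 ∨ 4 ≤ t) with rfl | rfl | rfl | h4
  · -- `t = 1`: the diagonal, every graph with `m ≤ k` edges
    have := cherries_le_choose_two_add_two D (by omega)
    omega
  · -- `t = 2`: the row `m = k + 1`, every `k`
    have := cherries_le_choose_two_add_four_of_k4mFree D hK (by omega)
    omega
  · -- `t = 3`: the row `m = k + 2`, `k ≥ 6`
    have := cherries_le_choose_two_add_six_of_k4mFree D hK (by omega) (by omega)
    omega
  · exact cherries_le_choose_two_add_two_mul_of_k4mFree t h4 D hK hk hm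

/-- **THE TABLE ABOVE THE THRESHOLD, EXACT:** for `t ≥ 1`, `t² + 6 ≤ 2k + t` and `2t + 1 ≤ k`, the `K₄⁻`-free
cherry maximum at `(k, k − 1 + t)` is exactly `C(k − 1, 2) + 2t`, attained by the star plus `t` disjoint leaf
edges. -/
theorem rows_exact (t k : ℕ) (ht : 1 ≤ t) (hk : t * t + 6 ≤ 2 * k + t) (hk2 : 2 * t + 1 ≤ k) :
    (∀ (D : SimpleGraph (Fin k)) [DecidableRel D.Adj], K4mFree D → D.edgeFinset.card + 1 = k + t →
        cherries D ≤ (k - 1).choose 2 + 2 * t) ∧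
      ∃ (D : SimpleGraph (Fin k)) (_ : DecidableRel D.Adj),
        K4mFree D ∧ D.edgeFinset.card + 1 = k + t ∧ cherries D = (k - 1).choose 2 + 2 * t := by
  refine ⟨fun D _ hK hD => ?_, exists_k4mFree_row_general k t hk2⟩
  have := cherries_le_star_value t ht D hK (by simpa using hk) (by rw [hD]; simp)
  simpa using this

/-- The thresholds `(t² − t + 6)/2` of the first rows: `3, 4, 6, 9, 13, 18` at `t = 1 … 6`. -/
theorem thresholds_values :
    (1 * 1 + 6 ≤ 2 * 3 + 1) ∧ (2 * 2 + 6 ≤ 2 * 4 + 2) ∧ (3 * 3 + 6 ≤ 2 * 6 + 3) ∧ (4 * 4 + 6 ≤ 2 * 9 + 4) ∧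
      (5 * 5 + 6 ≤ 2 * 13 + 5) ∧ (6 * 6 + 6 ≤ 2 * 18 + 6) ∧
      ¬ (3 * 3 + 6 ≤ 2 * 5 + 3) ∧ ¬ (4 * 4 + 6 ≤ 2 * 8 + 4) ∧ ¬ (5 * 5 + 6 ≤ 2 * 12 + 5) := by
  decide

end C047

end TriangleCap

end PercRepro
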